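import Mathlib
import Literature.MathematicalPhysics.QuantumFieldTheory.Balaban1983to89.TreeLength

/-!
# `Balaban1983to89.B16.SupCountFloor` — the floor of the cube-count constant in the cell's typed (SUP-metric)
tree-length model, against the count used behind [Balaban1989LargeFieldII] (1.93) p. 388 / p. 385

CITATION HEADER (lean-in-tree rule 2026-08-18).  Sources: T. Bałaban, *Large field renormalization. II. Localization,
exponentiation, and bounds for the 𝐑 operation*, Commun. Math. Phys. **122**, 355–392 (1989) [Balaban1989LargeFieldII]
(cell paper B16; held `paper:balaban1989-cmp122-large-field-ii`, journal page = PDF page + 354): p. 385 [PDF 31] prints the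
count of M-cubes met by a tree graph in the form «7^d(3·2^{d−1}d′₁(Z₁^{(i)}) + 2^d)» (slope 3·2^{d−1}, additive 2^d), and
(1.93) p. 388 [PDF 34] uses the reciprocal constant (3·2^d)^{−1} against the exponents ½βκd_{k,Z′}(Y); T. Bałaban,
*Renormalization group approach to lattice gauge field theories. I*, Commun. Math. Phys. **109**, 249–301 (1987)
[Balaban1987RG1] p. 257 (definition of the linear size d_j; NO METRIC NAMED — cell DIVERGENCE.md D-T2); J. Dimock, *The
renormalization group according to Bałaban II. Large fields*, J. Math. Phys. **54**, 092301 (2013), arXiv:1212.5562v2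
[Dimock2013BalabanII] App. E («We use the metric |x − y| = sup_μ |x_μ − y_μ|» — the convention of the cell's typed model
`…Balaban1983to89.TreeLength`, unit pv22: `len` = sum of SUP-metric segment lengths).  The Bałaban papers are manuscripts
UNDER ADJUDICATION by the audit cell `pub-balaban`: nothing printed in them is asserted here; every `theorem` below is an
elementary statement about ONE explicit segment and 2^{d+1} − 1 explicit unit cubes, proved without `sorry` and without
new axioms.  NEW satellite module of unit `b2b-balaban-b01` (gen 15; cell records GAPS.md C-b01g15-1 v1.1 §8,
DIVERGENCE.md D-b01g15.1); it imports `…TreeLength` (pv22) and modifies nothing.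

WHAT IS PROVED (d arbitrary unless stated).  `diagSeg d` is the unit diagonal segment 0 → (1,…,1) of ℝ^d (sup-length 1 for
d ≥ 1, `len_diag`); `diagCubes d` is the set of the 2^{d+1} − 1 unit cubes having 0 or (1,…,1) as a vertex
(`card_diagCubes`); the one-segment graph `[diagSeg d]` is Steiner-admissible for `diagCubes d` (`sAdmissible_diag`: it is
connected and meets every one of these closed cubes, at an endpoint).  CONSEQUENCES: (1) `count_floor` — if a linear count
`SAdmissible Y T → #Y ≤ c·len T + 2^d` holds in the typed model for all Y, T (d ≥ 1), then c ≥ 2^d − 1; (2) the constant of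
the EUCLIDEAN volume (Cauchy–Steiner / Minkowski) count, 2^{d−1}√d — the one behind the cell row GAPS.md C-adv7-67 (c) —
is REFUTED as a sup-metric constant for d = 2 (`euclidConst_fails_two`: 7 > 2√2 + 4) and d = 3 (`euclidConst_fails_three`:
15 > 4√3 + 8), and at d = 4 the diagonal sits exactly one below it (`diag_four`: 31 cubes, length 1, versus 16·1 + 16 = 32);
(3) `inTree_const_vs_floor_four` — numerically, at d = 4: floor 15 < 24 = 3·2^{d−1} (the slope (1.93) needs) < 32 = d·2^{d−1}
(what the volume route gives for the sup length) < 64 = 4·2^d (the in-tree `TreeLength.card_le_of_sAdmissible_len`).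
WHAT IS *NOT* PROVED: any upper count with slope < 4·2^d in the sup metric (the sharp sup-metric slope for connected
polygonal graphs — conjecturally 2^d − 1 — is OPEN in the cell, D-b01g15.1); anything about the Euclidean or ℓ¹ lengths
(not typed).  Value: kernel-checked bookkeeping fixing the floor of a typing target, NOT summit progress.
-/

namespace Literature.MathematicalPhysics.QuantumFieldTheory.Balaban1983to89.B16.SupCountFloor

noncomputable section

open Literature.MathematicalPhysics.QuantumFieldTheory.Balaban1983to89.B13ScaleTransfer (Pt)
open Literature.MathematicalPhysics.QuantumFieldTheory.Balaban1983to89.TreeLength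

variable {d : ℕ}

/-- The unit diagonal segment of ℝ^d from the origin to (1,…,1). [folklore] -/
def diagSeg (d : ℕ) : Seg d := (fun _ => 0, fun _ => 1)

/-- The unit cubes of index in {−1,0}^d ∪ {0,1}^d, i.e. the closed unit cubes having the origin or (1,…,1) as a vertex. [folklore] -/
def diagCubes (d : ℕ) : Finset (Pt d) :=
  (Fintype.piFinset fun _ : Fin d => ({-1, 0} : Finset ℤ)) ∪ (Fintype.piFinset fun _ : Fin d => ({0, 1} : Finset ℤ))

/-- The sup-metric length of the unit diagonal is 1 (d ≥ 1). [folklore] -/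
theorem len_diag (hd : 0 < d) : len [diagSeg d] = 1 := by
  haveI : Nonempty (Fin d) := ⟨⟨0, hd⟩⟩
  simp [diagSeg, len, dist_pi_const]

/-- The two vertex-stars {−1,0}^d and {0,1}^d share exactly the cube of index 0. [folklore] -/
theorem inter_eq :
    (Fintype.piFinset fun _ : Fin d => ({-1, 0} : Finset ℤ)) ∩ (Fintype.piFinset fun _ : Fin d => ({0, 1} : Finset ℤ))
      = {fun _ => 0} := by
  ext z
  simp only [Finset.mem_inter, Fintype.mem_piFinset, Finset.mem_insert, Finset.mem_singleton]
  constructor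
  · rintro ⟨h1, h2⟩
    funext i
    rcases h1 i with h | h <;> rcases h2 i with h' | h' <;> omega
  · rintro rfl
    exact ⟨fun _ => Or.inr rfl, fun _ => Or.inl rfl⟩

/-- `diagCubes d` has exactly 2^{d+1} − 1 elements. [folklore] -/
theorem card_diagCubes : (diagCubes d).card = 2 ^ (d + 1) - 1 := by
  have hA : (Fintype.piFinset fun _ : Fin d => ({-1, 0} : Finset ℤ)).card = 2 ^ d := by
    rw [Fintype.card_piFinset, Finset.prod_const, Finset.card_univ, Fintype.card_fin, Finset.card_pair (by norm_num)]
  have hB : (Fintype.piFinset fun _ : Fin d => ({0, 1} : Finset ℤ)).card = 2 ^ d := by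
    rw [Fintype.card_piFinset, Finset.prod_const, Finset.card_univ, Fintype.card_fin, Finset.card_pair (by norm_num)]
  have h := Finset.card_union_add_card_inter
    (Fintype.piFinset fun _ : Fin d => ({-1, 0} : Finset ℤ)) (Fintype.piFinset fun _ : Fin d => ({0, 1} : Finset ℤ))
  rw [inter_eq, Finset.card_singleton, hA, hB] at h
  rw [diagCubes, pow_succ]
  omega

/-- The one-segment graph `[diagSeg d]` is Steiner-admissible for `diagCubes d`: connected, and meeting each of these
closed cubes (at the endpoint 0, resp. (1,…,1)). [folklore] -/
theorem sAdmissible_diag : SAdmissible (diagCubes d) [diagSeg d] := by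
  have hcar : carrier [diagSeg d] = segment ℝ (diagSeg d).1 (diagSeg d).2 := by simp
  refine ⟨?_, ?_⟩
  · rw [hcar]
    exact ((convex_segment _ _).isPathConnected ⟨_, left_mem_segment ℝ _ _⟩).isConnected
  · intro y hy
    rw [hcar]
    rcases Finset.mem_union.1 hy with h | h
    · refine ⟨(diagSeg d).1, left_mem_segment ℝ _ _, mem_cube.2 fun i => ?_⟩
      have := (Fintype.mem_piFinset.1 h) i
      simp only [Finset.mem_insert, Finset.mem_singleton] at this
      rcases this with h' | h' <;> simp [diagSeg, h']
    · refine ⟨(diagSeg d).2, right_mem_segment ℝ _ _, mem_cube.2 fun i => ?_⟩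
      have := (Fintype.mem_piFinset.1 h) i
      simp only [Finset.mem_insert, Finset.mem_singleton] at this
      rcases this with h' | h' <;> simp [diagSeg, h']

/-- FLOOR OF THE SUP-METRIC COUNT CONSTANT: if `#Y ≤ c · len T + 2^d` for every Steiner-admissible pair in the typed
(sup-metric) model, then c ≥ 2^d − 1 (d ≥ 1). [folklore] -/
theorem count_floor (hd : 0 < d) {c : ℝ}
    (h : ∀ (Y : Finset (Pt d)) (T : List (Seg d)), SAdmissible Y T → (Y.card : ℝ) ≤ c * len T + 2 ^ d) :
    (2 : ℝ) ^ d - 1 ≤ c := by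
  have h1 := h _ _ (sAdmissible_diag (d := d))
  rw [card_diagCubes, len_diag hd, Nat.cast_sub Nat.one_le_two_pow] at h1
  push_cast at h1
  rw [pow_succ] at h1
  linarith

/-- The Euclidean volume constant 2^{d−1}√d is NOT a valid sup-metric count constant at d = 2 (2√2 + 4 < 7). [folklore] -/
theorem euclidConst_fails_two :
    ¬ ∀ (Y : Finset (Pt 2)) (T : List (Seg 2)), SAdmissible Y T →
      (Y.card : ℝ) ≤ 2 ^ (2 - 1) * Real.sqrt 2 * len T + 2 ^ 2 := by
  intro h
  have hf := count_floor (d := 2) (by norm_num) h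
  have hs : Real.sqrt 2 < 3 / 2 := by
    rw [Real.sqrt_lt' (by norm_num)]
    norm_num
  norm_num at hf
  linarith

/-- The Euclidean volume constant 2^{d−1}√d is NOT a valid sup-metric count constant at d = 3 (4√3 + 8 < 15). [folklore] -/
theorem euclidConst_fails_three :
    ¬ ∀ (Y : Finset (Pt 3)) (T : List (Seg 3)), SAdmissible Y T →
      (Y.card : ℝ) ≤ 2 ^ (3 - 1) * Real.sqrt 3 * len T + 2 ^ 3 := by
  intro h
  have hf := count_floor (d := 3) (by norm_num) h
  have hs : Real.sqrt 3 < 7 / 4 := by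
    rw [Real.sqrt_lt' (by norm_num)]
    norm_num
  norm_num at hf
  linarith

/-- At d = 4 the unit diagonal meets 31 cubes with sup-length 1 — one below the Euclidean-constant value 2^{d−1}√d·1 + 2^d = 32,
and 2^4 − 1 = 15 per unit length above the additive 2^4. [folklore] -/
theorem diag_four : (diagCubes 4).card = 31 ∧ len [diagSeg 4] = 1 ∧
    (2 : ℝ) ^ (4 - 1) * Real.sqrt 4 * 1 + 2 ^ 4 = 32 := by
  refine ⟨by rw [card_diagCubes]; norm_num, len_diag (by norm_num), ?_⟩
  have : Real.sqrt 4 = 2 := by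
    rw [show (4 : ℝ) = 2 ^ 2 by norm_num, Real.sqrt_sq (by norm_num)]
  rw [this]; norm_num

/-- The four constants at d = 4, in order: floor 2^d − 1 = 15 (this module) < 3·2^{d−1} = 24 (the slope (1.93) needs) <
d·2^{d−1} = 32 (Euclidean volume route transplanted to the sup length) < 4·2^d = 64 (in-tree `card_le_of_sAdmissible_len`). [folklore] -/
theorem inTree_const_vs_floor_four :
    (2 : ℝ) ^ 4 - 1 = 15 ∧ (3 : ℝ) * 2 ^ (4 - 1) = 24 ∧ (4 : ℝ) * 2 ^ (4 - 1) = 32 ∧ (4 : ℝ) * 2 ^ 4 = 64 := by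
  norm_num

/-- The in-tree count is consistent with the floor: 4·2^d ≥ 2^d − 1, instantiated through `count_floor` (d ≥ 1). [folklore] -/
theorem floor_le_inTree (hd : 0 < d) : (2 : ℝ) ^ d - 1 ≤ 2 ^ d * 4 := by
  refine count_floor hd fun Y T hT => ?_
  have := card_le_of_sAdmissible_len hT
  linarith

end

end Literature.MathematicalPhysics.QuantumFieldTheory.Balaban1983to89.B16.SupCountFloor
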